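import Literature.NumberTheory.Transcendental.ChudnovskyMainBounds
import Literature.NumberTheory.Transcendental.ChudnovskyEnvelope
import HarnessLib

/-!
# Brownawell–Waldschmidt: the algebraic envelope in `m` variables

`Literature/NumberTheory/Transcendental/BWEnvelope.lean` — first file of the proof of the
Brownawell–Waldschmidt theorem (Baker 1975, Ch. 12, Thm 12.2; LNM 1752, Ch. 14, Thm 2.9,
"Moreover" clause; named fact `Literature.Barriers.Schanuel.smallTrdeg_thm_2_9_two_two`).

Gelfond's method in the "transcendence degree `1`" situation works over `ℤ[θ]`, `θ`
transcendental, with finitely many numbers `x₀, …, x_{m-1}` algebraic over `ℚ(θ)`. The tree's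
proof of Chudnovsky's theorem packaged the necessary algebra (regular representation of
`ℚ(θ)(x)` over `ℚ(θ)` with denominators cleared, the eigenvector relation, the norm to `ℤ[θ]` as a
determinant, degree and height bookkeeping) in `ChudnovskyHeights.lean`,
`ChudnovskyEnvelope.lean`, `ChudnovskyMainBounds.lean` — but for exactly four numbers
(`Fin 4`, ordered products written out). This file is the same material for `Fin m`
(the Brownawell–Waldschmidt construction has `m = 8` generators): ordered monomials of matrices
by recursion on `m` (`monoEval`), the `b`-homogenised evaluation `homEval`, the specialisation
`evC`, the structure `Envelope` and its existence `exists_envelope`, the eigenvector relation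
`Envelope.vecMul_homEval`, and the entry bounds `seminorm_homEval_entry_le`,
`natDegree_homEval_entry_le`. Proofs are those of the `Fin 4` files, with the four-fold products
replaced by inductions on `m`; the weighted norms `wnorm`/`zl1`/`l1`, Siegel's lemma
`siegel_poly`, the determinant bounds and the cofactor bound are used from the `Chudnovsky`
namespace unchanged.

## References

* [BakerTNT1975] A. Baker, *Transcendental Number Theory*, CUP (1975), Ch. 12 §5, pp. 116–118
  ("taking the product of its conjugates over `ℚ(ω)` we derive a polynomial `P(x)`").
* [Chudnovsky1984] G. V. Chudnovsky, *Contributions to the theory of transcendental numbers*,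
  AMS (1984), Ch. 7 §2, p. 307 (the same device; tree files `Chudnovsky*.lean`).
-/

noncomputable section

open scoped Polynomial IntermediateField
open MvPolynomial Finset Matrix

namespace Literature.NumberTheory.Transcendental.BrownawellWaldschmidt

open Literature.NumberTheory.Transcendental.Chudnovsky

/-! ### Ordered monomials of matrices and the homogenised evaluation -/

section HomEval

variable {R S : Type*} [CommRing R] [CommRing S] {d : ℕ}

/-- Ordered evaluation of the monomial `a^k = a₀^{k₀} ⋯ a_{m-1}^{k_{m-1}}` at `m` square matrices,
`N₀^{k₀} N₁^{k₁} ⋯` (no commutativity assumed), by recursion on `m`. [folklore] -/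
def monoEval : {m : ℕ} → (Fin m → Matrix (Fin d) (Fin d) R) → (Fin m → ℕ) → Matrix (Fin d) (Fin d) R
  | 0, _, _ => 1
  | _ + 1, N, k => N 0 ^ k 0 * monoEval (fun l => N l.succ) (fun l => k l.succ)

/-- `monoEval` with no variables is `1`. [folklore] -/
@[simp] lemma monoEval_fin_zero (N : Fin 0 → Matrix (Fin d) (Fin d) R) (k : Fin 0 → ℕ) :
    monoEval N k = 1 := rfl

/-- The recursion step of `monoEval`. [folklore] -/
lemma monoEval_succ {m : ℕ} (N : Fin (m + 1) → Matrix (Fin d) (Fin d) R) (k : Fin (m + 1) → ℕ) :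
    monoEval N k = N 0 ^ k 0 * monoEval (fun l => N l.succ) (fun l => k l.succ) := rfl

/-- `monoEval N 0 = 1`. [folklore] -/
@[simp] lemma monoEval_zero {m : ℕ} (N : Fin m → Matrix (Fin d) (Fin d) R) :
    monoEval N (fun _ => 0) = 1 := by
  induction m with
  | zero => rfl
  | succ m ih => rw [monoEval_succ, pow_zero, one_mul]; exact ih _

/-- Naturality of `monoEval` under a ring map. [folklore] -/
lemma monoEval_map {m : ℕ} (φ : R →+* S) (N : Fin m → Matrix (Fin d) (Fin d) R) (k : Fin m → ℕ) :
    (monoEval N k).map φ = monoEval (fun l => (N l).map φ) k := by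
  induction m with
  | zero => simp [monoEval]
  | succ m ih => rw [monoEval_succ, monoEval_succ, Matrix.map_mul, Matrix.map_pow, ih]

/-- Pulling scalars out: `monoEval (c • M) k = c^{∑ k} • monoEval M k`. [folklore] -/
lemma monoEval_smul {m : ℕ} (c : S) (M : Fin m → Matrix (Fin d) (Fin d) S) (k : Fin m → ℕ) :
    monoEval (fun l => c • M l) k = c ^ (∑ l, k l) • monoEval M k := by
  induction m with
  | zero => simp [monoEval]
  | succ m ih =>
    rw [monoEval_succ, monoEval_succ, ih, smul_pow, Fin.sum_univ_succ, pow_add, Matrix.smul_mul,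
      Matrix.mul_smul, smul_smul]

/-- A ring map evaluates monomials as ordered products: `φ(∏ X_l^{k_l}) = monoEval (φ ∘ X) k`.
[folklore] -/
lemma map_prod_X_pow_eq_monoEval {A : Type*} [CommRing A] {m : ℕ}
    (φ : MvPolynomial (Fin m) A →+* Matrix (Fin d) (Fin d) S) (k : Fin m → ℕ) :
    φ (∏ l, X l ^ k l) = monoEval (fun l => φ (X l)) k := by
  induction m with
  | zero => simp [monoEval]
  | succ m ih =>
    rw [Fin.prod_univ_succ, map_mul, map_pow, monoEval_succ]
    congr 1
    -- reindex the variables `X (succ l)` of `MvPolynomial (Fin (m+1)) A` via `MvPolynomial (Fin m) A`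
    have h := ih (φ.comp (MvPolynomial.rename Fin.succ).toRingHom) (fun l => k l.succ)
    simpa [map_prod, map_pow, MvPolynomial.rename_X] using h

/-- A ring map evaluates `monomial α 1` as the ordered product `monoEval (φ ∘ X) α`. [folklore] -/
lemma map_monomial_eq_monoEval {A : Type*} [CommRing A] {m : ℕ}
    (φ : MvPolynomial (Fin m) A →+* Matrix (Fin d) (Fin d) S) (α : Fin m →₀ ℕ) :
    φ (monomial α 1) = monoEval (fun l => φ (X l)) α := by
  have : (monomial α (1 : A) : MvPolynomial (Fin m) A) = ∏ l, X l ^ α l := by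
    rw [monomial_eq, C_1, one_mul, Finsupp.prod_fintype _ _ (by simp)]
  rw [this, map_prod_X_pow_eq_monoEval]

/-- The **`b`-homogenised evaluation** of `P = ∑_α c_α a^α ∈ R[a₀, …, a_{m-1}]` at `m` matrices:
`homEval N b n P = ∑_α c_α b^{n - |α|} N^α`. [folklore] -/
def homEval {m : ℕ} (N : Fin m → Matrix (Fin d) (Fin d) R) (b : R) (n : ℕ)
    (P : MvPolynomial (Fin m) R) : Matrix (Fin d) (Fin d) R :=
  ∑ α ∈ P.support, (P.coeff α * b ^ (n - α.degree)) • monoEval N α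

variable {m : ℕ} (N : Fin m → Matrix (Fin d) (Fin d) R) (b : R) (n : ℕ)

/-- The sum defining `homEval` may be taken over any finite set containing the support.
[folklore] -/
lemma homEval_eq_sum_of_subset {P : MvPolynomial (Fin m) R} {T : Finset (Fin m →₀ ℕ)}
    (h : P.support ⊆ T) :
    homEval N b n P = ∑ α ∈ T, (P.coeff α * b ^ (n - α.degree)) • monoEval N α := by
  unfold homEval
  refine Finset.sum_subset h fun α _ hα => ?_
  rw [notMem_support_iff.mp hα, zero_mul, zero_smul]

/-- `homEval` of a monomial. [folklore] -/
lemma homEval_monomial (α : Fin m →₀ ℕ) (c : R) :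
    homEval N b n (monomial α c) = (c * b ^ (n - α.degree)) • monoEval N α := by
  classical
  rw [homEval_eq_sum_of_subset N b n (support_monomial_subset (s := α) (a := c))]
  simp

/-- `homEval N b n 0 = 0`. [folklore] -/
@[simp] lemma homEval_zero' : homEval N b n (0 : MvPolynomial (Fin m) R) = 0 := by
  simp [homEval]

/-- Additivity of `homEval`. [folklore] -/
lemma homEval_add (P Q : MvPolynomial (Fin m) R) :
    homEval N b n (P + Q) = homEval N b n P + homEval N b n Q := by
  classical
  rw [homEval_eq_sum_of_subset N b n (support_add (p := P) (q := Q)),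
    homEval_eq_sum_of_subset N b n (Finset.subset_union_left (s₁ := P.support) (s₂ := Q.support)),
    homEval_eq_sum_of_subset N b n
      (Finset.subset_union_right (s₁ := P.support) (s₂ := Q.support)),
    ← Finset.sum_add_distrib]
  refine Finset.sum_congr rfl fun α _ => ?_
  rw [coeff_add, add_mul, add_smul]

/-- `homEval` of a finite sum. [folklore] -/
lemma homEval_sum {ι : Type*} (s : Finset ι) (f : ι → MvPolynomial (Fin m) R) :
    homEval N b n (∑ i ∈ s, f i) = ∑ i ∈ s, homEval N b n (f i) := by
  classical
  induction s using Finset.induction_on with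
  | empty => simp
  | insert a s ha ih => rw [Finset.sum_insert ha, Finset.sum_insert ha, homEval_add, ih]

/-- `R`-linearity of `homEval`: `homEval (C c * P) = c • homEval P`. [folklore] -/
lemma homEval_C_mul (c : R) (P : MvPolynomial (Fin m) R) :
    homEval N b n (C c * P) = c • homEval N b n P := by
  classical
  have hsupp : (C c * P).support ⊆ P.support := by
    intro α hα
    rw [mem_support_iff] at hα ⊢
    rw [coeff_C_mul] at hα
    exact fun h => hα (by rw [h, mul_zero])
  rw [homEval_eq_sum_of_subset N b n hsupp, homEval, Finset.smul_sum]
  refine Finset.sum_congr rfl fun α _ => ?_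
  rw [coeff_C_mul, smul_smul, mul_assoc]

/-- Naturality of `homEval` under a ring map `φ`. [folklore] -/
lemma homEval_map (φ : R →+* S) (P : MvPolynomial (Fin m) R) :
    (homEval N b n P).map φ =
      homEval (fun l => (N l).map φ) (φ b) n (MvPolynomial.map φ P) := by
  classical
  rw [homEval_eq_sum_of_subset _ _ n (support_map_subset φ P), homEval]
  change φ.mapMatrix (∑ α ∈ P.support, (P.coeff α * b ^ (n - α.degree)) • monoEval N α) = _
  rw [map_sum]
  refine Finset.sum_congr rfl fun α _ => ?_
  rw [MvPolynomial.coeff_map, ← monoEval_map]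
  ext i j
  simp only [RingHom.mapMatrix_apply, Matrix.map_apply, Matrix.smul_apply, smul_eq_mul, map_mul,
    map_pow]

end HomEval

/-! ### Entry bounds -/

section Bounds

variable {R : Type*} [CommRing R] (ν : RingSeminorm R) {d : ℕ}

/-- Entries of an ordered monomial: `ν ((N^k)_{ij}) ≤ d^m (d H)^{∑ k}` (`H ≥ 1`, `ν 1 ≤ 1`).
[folklore] -/
lemma seminorm_monoEval_entry_le (h1 : ν 1 ≤ 1) {H : ℝ} (hH : 1 ≤ H) :
    ∀ {m : ℕ} (N : Fin m → Matrix (Fin d) (Fin d) R) (_hN : ∀ l i j, ν (N l i j) ≤ H)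
      (k : Fin m → ℕ) (i j : Fin d), ν (monoEval N k i j) ≤ (d : ℝ) ^ m * (d * H) ^ (∑ l, k l) := by
  intro m
  induction m with
  | zero =>
    intro N _ k i j
    simp only [monoEval_fin_zero, pow_zero, Finset.univ_eq_empty, Finset.sum_empty, mul_one]
    rw [Matrix.one_apply]
    split_ifs
    · exact h1
    · rw [map_zero]; exact zero_le_one
  | succ m ih =>
    intro N hN k i j
    have hd : (1 : ℝ) ≤ d := by
      have : 0 < d := Fin.pos i
      exact_mod_cast this
    rw [monoEval_succ, Fin.sum_univ_succ]
    have hp := seminorm_pow_entry_le ν h1 hH (hN 0) (k 0)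
    have ht := ih (fun l => N l.succ) (fun l => hN l.succ) (fun l => k l.succ)
    refine (seminorm_mul_entry_le ν (by positivity) hp ht i j).trans (le_of_eq ?_)
    rw [pow_succ, pow_add]
    ring

/-- **Entries of `homEval`**: if `ν b ≤ H`, `ν (N_l)_{ij} ≤ H` (`H ≥ 1`) and all monomials of
`P` have degree `≤ n`, then `ν ((homEval N b n P)_{ij}) ≤ wnorm ν P · d^m (dH)^n`. [folklore] -/
theorem seminorm_homEval_entry_le (h1 : ν 1 ≤ 1) {m : ℕ} {N : Fin m → Matrix (Fin d) (Fin d) R}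
    {b : R} {H : ℝ} (hH : 1 ≤ H) (hN : ∀ l i j, ν (N l i j) ≤ H) (hb : ν b ≤ H) {n : ℕ}
    {P : MvPolynomial (Fin m) R} (hP : ∀ α ∈ P.support, α.degree ≤ n) (i j : Fin d) :
    ν (homEval N b n P i j) ≤ wnorm ν P * ((d : ℝ) ^ m * (d * H) ^ n) := by
  have hd : (1 : ℝ) ≤ d := by
    have : 0 < d := Fin.pos i
    exact_mod_cast this
  unfold homEval
  rw [Matrix.sum_apply]
  refine (seminorm_sum_le ν _ _).trans ?_
  unfold wnorm
  rw [Finset.sum_mul]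
  refine Finset.sum_le_sum fun α hα => ?_
  rw [Matrix.smul_apply, smul_eq_mul]
  refine (map_mul_le_mul ν _ _).trans ?_
  have hdegsum : (∑ l, α l) = α.degree := (Finsupp.degree_eq_sum α).symm
  have hmono := seminorm_monoEval_entry_le ν h1 hH N hN α i j
  rw [hdegsum] at hmono
  refine (mul_le_mul (map_mul_le_mul ν _ _) hmono
    (apply_nonneg _ _) (mul_nonneg (apply_nonneg _ _) (apply_nonneg _ _))).trans ?_
  have hbn : ν (b ^ (n - α.degree)) ≤ (d * H) ^ (n - α.degree) := by
    refine (map_pow_le_pow' h1 b _).trans ?_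
    exact pow_le_pow_left₀ (apply_nonneg _ _) (hb.trans (by nlinarith)) _
  have hαn := hP α hα
  calc ν (P.coeff α) * ν (b ^ (n - α.degree)) * ((d : ℝ) ^ m * (d * H) ^ α.degree)
      ≤ ν (P.coeff α) * (d * H) ^ (n - α.degree) * ((d : ℝ) ^ m * (d * H) ^ α.degree) := by
        gcongr
    _ = ν (P.coeff α) * ((d : ℝ) ^ m * (d * H) ^ n) := by
        rw [show (d * H : ℝ) ^ n = (d * H) ^ (n - α.degree) * (d * H) ^ α.degree by
          rw [← pow_add, Nat.sub_add_cancel hαn]]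
        ring

/-- Entries of an ordered monomial over `ℤ[T]`: `deg ≤ (∑ k) δ₀`. [folklore] -/
lemma natDegree_monoEval_entry_le {δ₀ : ℕ} :
    ∀ {m : ℕ} (N : Fin m → Matrix (Fin d) (Fin d) ℤ[X]) (_hN : ∀ l i j, (N l i j).natDegree ≤ δ₀)
      (k : Fin m → ℕ) (i j : Fin d), (monoEval N k i j).natDegree ≤ (∑ l, k l) * δ₀ := by
  intro m
  induction m with
  | zero =>
    intro N _ k i j
    simp only [monoEval_fin_zero, Finset.univ_eq_empty, Finset.sum_empty, zero_mul,
      nonpos_iff_eq_zero]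
    rw [Matrix.one_apply]
    split_ifs <;> simp
  | succ m ih =>
    intro N hN k i j
    rw [monoEval_succ, Fin.sum_univ_succ, Nat.add_mul]
    exact natDegree_mul_entry_le (natDegree_pow_entry_le (hN 0) (k 0))
      (ih (fun l => N l.succ) (fun l => hN l.succ) (fun l => k l.succ)) i j

/-- **Degrees of the entries of `homEval`** over `ℤ[T]`: `≤ δ_P + n δ₀`. [folklore] -/
theorem natDegree_homEval_entry_le {m : ℕ} {N : Fin m → Matrix (Fin d) (Fin d) ℤ[X]} {b : ℤ[X]}
    {δ₀ δP n : ℕ} (hN : ∀ l i j, (N l i j).natDegree ≤ δ₀) (hb : b.natDegree ≤ δ₀)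
    {P : MvPolynomial (Fin m) ℤ[X]} (hP : ∀ α ∈ P.support, α.degree ≤ n)
    (hPc : ∀ α, (P.coeff α).natDegree ≤ δP) (i j : Fin d) :
    (homEval N b n P i j).natDegree ≤ δP + n * δ₀ := by
  unfold homEval
  rw [Matrix.sum_apply]
  refine Polynomial.natDegree_sum_le_of_forall_le _ _ fun α hα => ?_
  rw [Matrix.smul_apply, smul_eq_mul]
  refine Polynomial.natDegree_mul_le.trans ?_
  have h1 : (P.coeff α * b ^ (n - α.degree)).natDegree ≤ δP + (n - α.degree) * δ₀ :=
    Polynomial.natDegree_mul_le.trans (add_le_add (hPc α)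
      (Polynomial.natDegree_pow_le.trans (Nat.mul_le_mul_left _ hb)))
  have h2 := natDegree_monoEval_entry_le N hN α i j
  rw [← Finsupp.degree_eq_sum] at h2
  have h3 := hP α hα
  have : (n - α.degree) * δ₀ + α.degree * δ₀ = n * δ₀ := by
    rw [← Nat.add_mul, Nat.sub_add_cancel h3]
  omega

end Bounds

/-! ### The specialisation `ℤ[T][a₀, …, a_{m-1}] → ℂ` and the envelope -/

/-- The specialisation `ℤ[T][a₀, …, a_{m-1}] → ℂ`, `T ↦ θ`, `a_l ↦ x_l`. [folklore] -/
def evC {m : ℕ} (θ : ℂ) (x : Fin m → ℂ) : MvPolynomial (Fin m) ℤ[X] →+* ℂ :=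
  MvPolynomial.eval₂Hom (Polynomial.aeval θ : ℤ[X] →ₐ[ℤ] ℂ).toRingHom x

/-- `evC` on coefficients. [folklore] -/
@[simp] lemma evC_C {m : ℕ} (θ : ℂ) (x : Fin m → ℂ) (p : ℤ[X]) :
    evC θ x (C p) = Polynomial.aeval θ p := by
  simp [evC]

/-- `evC` on variables. [folklore] -/
@[simp] lemma evC_X {m : ℕ} (θ : ℂ) (x : Fin m → ℂ) (l : Fin m) : evC θ x (X l) = x l := by
  simp [evC]

/-- `evC` of an integer polynomial (coefficients in `ℤ ⊂ ℤ[T]`) is its value at `x`. [folklore] -/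
lemma evC_map_C {m : ℕ} (θ : ℂ) (x : Fin m → ℂ) (V : MvPolynomial (Fin m) ℤ) :
    evC θ x (MvPolynomial.map (Polynomial.C : ℤ →+* ℤ[X]) V) = MvPolynomial.aeval x V := by
  have h : (Polynomial.aeval θ : ℤ[X] →ₐ[ℤ] ℂ).toRingHom.comp (Polynomial.C : ℤ →+* ℤ[X]) =
      algebraMap ℤ ℂ := RingHom.ext_int _ _
  rw [evC, MvPolynomial.eval₂Hom_map_hom, h, MvPolynomial.aeval_def, MvPolynomial.coe_eval₂Hom]

/-- An **algebraic envelope** of `(θ; x₀, …, x_{m-1})`: the regular representation of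
`K = ℚ(θ)(x)` over `ℚ(θ)` on a basis `β`, denominators cleared (`N_l(θ) = b(θ)·(matrix of x_l)`),
keeping the eigenvector relation and the non-vanishing of the determinant of the representing
matrix of a nonzero element (the norm to `ℚ(θ)`). Copy of `Chudnovsky.Envelope` for `m`
variables. [folklore] -/
structure Envelope {m : ℕ} (θ : ℂ) (x : Fin m → ℂ) where
  /-- the degree `d = [K : ℚ(θ)]` -/
  d : ℕ
  d_pos : 0 < d
  /-- the numerators of the regular representation -/
  N : Fin m → Matrix (Fin d) (Fin d) ℤ[X]
  /-- the common denominator -/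
  b : ℤ[X]
  aeval_b_ne : Polynomial.aeval θ b ≠ 0
  /-- the basis of `K/ℚ(θ)`, as complex numbers -/
  β : Fin d → ℂ
  β_ne : β ≠ 0
  eigen : ∀ l : Fin m,
    Matrix.vecMul β ((N l).map (Polynomial.aeval θ : ℤ[X] →ₐ[ℤ] ℂ)) =
      (Polynomial.aeval θ b * x l) • β
  det_ne : ∀ (n : ℕ) (P : MvPolynomial (Fin m) ℤ[X]), (∀ α ∈ P.support, α.degree ≤ n) →
    evC θ x P ≠ 0 → Polynomial.aeval θ (homEval N b n P).det ≠ 0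

namespace Envelope

variable {m : ℕ} {θ : ℂ} {x : Fin m → ℂ} (E : Envelope θ x)

/-- The matrices `N_l(θ) ∈ M_d(ℂ)`. [folklore] -/
abbrev Nθ (l : Fin m) : Matrix (Fin E.d) (Fin E.d) ℂ :=
  (E.N l).map (Polynomial.aeval θ : ℤ[X] →ₐ[ℤ] ℂ)

/-- The eigenvector relation for ordered monomials: `β N(θ)^k = (∏ (b(θ) x_l)^{k_l}) β`.
[folklore] -/
lemma vecMul_monoEval_aux :
    ∀ {m : ℕ} (M : Fin m → Matrix (Fin E.d) (Fin E.d) ℂ) (c : Fin m → ℂ)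
      (_h : ∀ l, Matrix.vecMul E.β (M l) = c l • E.β) (k : Fin m → ℕ),
      Matrix.vecMul E.β (monoEval M k) = (∏ l, c l ^ k l) • E.β := by
  intro m
  induction m with
  | zero => intro M c _ k; simp
  | succ m ih =>
    intro M c h k
    rw [monoEval_succ, ← Matrix.vecMul_vecMul, Chudnovsky.Envelope.vecMul_pow_of_vecMul (h 0),
      Matrix.smul_vecMul,
      ih (fun l => M l.succ) (fun l => c l.succ) (fun l => h l.succ) (fun l => k l.succ), smul_smul,
      Fin.prod_univ_succ]

/-- The eigenvector relation for ordered monomials of the envelope: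
`β N(θ)^α = (b(θ))^{|α|} x^α β`. [folklore] -/
lemma vecMul_monoEval (α : Fin m →₀ ℕ) :
    Matrix.vecMul E.β (monoEval E.Nθ α) =
      ((Polynomial.aeval θ E.b) ^ α.degree * ∏ l, x l ^ α l) • E.β := by
  rw [vecMul_monoEval_aux E E.Nθ (fun l => Polynomial.aeval θ E.b * x l) E.eigen α]
  congr 1
  rw [Finsupp.degree_eq_sum]
  simp_rw [mul_pow]
  rw [Finset.prod_mul_distrib, Finset.prod_pow_eq_pow_sum]

/-- **The eigenvector relation for `homEval`.** If every monomial of `P ∈ ℤ[T][a]` has degree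
`≤ n`, then `β · (homEval N b n P)(θ) = b(θ)^n P(θ; x) · β`. [folklore] -/
theorem vecMul_homEval {n : ℕ} {P : MvPolynomial (Fin m) ℤ[X]}
    (hP : ∀ α ∈ P.support, α.degree ≤ n) :
    Matrix.vecMul E.β ((homEval E.N E.b n P).map (Polynomial.aeval θ : ℤ[X] →ₐ[ℤ] ℂ)) =
      ((Polynomial.aeval θ E.b) ^ n * evC θ x P) • E.β := by
  classical
  set φ : ℤ[X] →+* ℂ := (Polynomial.aeval θ : ℤ[X] →ₐ[ℤ] ℂ).toRingHom with hφ
  have hmap : (homEval E.N E.b n P).map (Polynomial.aeval θ : ℤ[X] →ₐ[ℤ] ℂ) =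
      (homEval E.N E.b n P).map φ := rfl
  rw [hmap, homEval_map, homEval_eq_sum_of_subset _ _ n (support_map_subset φ P),
    Matrix.vecMul_sum]
  have hev : evC θ x P = ∑ α ∈ P.support, φ (P.coeff α) * ∏ l, x l ^ α l := by
    rw [evC, MvPolynomial.coe_eval₂Hom, MvPolynomial.eval₂_eq]
    refine Finset.sum_congr rfl fun α _ => ?_
    congr 1
    rw [Finset.prod_subset (Finset.subset_univ α.support)]
    intro l _ hl
    rw [Finsupp.notMem_support_iff.mp hl, pow_zero]
  rw [hev, Finset.mul_sum, Finset.sum_smul]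
  refine Finset.sum_congr rfl fun α hα => ?_
  rw [Matrix.vecMul_smul, MvPolynomial.coeff_map]
  change (φ (P.coeff α) * φ E.b ^ (n - α.degree)) • Matrix.vecMul E.β (monoEval E.Nθ α) = _
  rw [vecMul_monoEval, smul_smul]
  congr 1
  have hdeg := hP α hα
  have : φ E.b = Polynomial.aeval θ E.b := rfl
  rw [this, ← mul_assoc, mul_assoc (φ (P.coeff α)), ← pow_add, Nat.sub_add_cancel hdeg]
  ring

/-- A polynomial identity `homEval N b n P = 0` in `M_d(ℤ[T])` forces `P(θ; x) = 0`.
[folklore] -/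
theorem evC_eq_zero_of_homEval_eq_zero {n : ℕ} {P : MvPolynomial (Fin m) ℤ[X]}
    (hP : ∀ α ∈ P.support, α.degree ≤ n) (h0 : homEval E.N E.b n P = 0) : evC θ x P = 0 := by
  have h := E.vecMul_homEval hP
  rw [h0] at h
  simp only [Matrix.map_zero, map_zero, Matrix.vecMul_zero] at h
  obtain ⟨i, hi⟩ := Function.ne_iff.mp E.β_ne
  have := congr_fun h i
  simp only [Pi.zero_apply, Pi.smul_apply, smul_eq_mul] at this
  rcases mul_eq_zero.mp this.symm with h1 | h1
  · rcases mul_eq_zero.mp h1 with h2 | h2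
    · exact absurd (eq_zero_of_pow_eq_zero h2) E.aeval_b_ne
    · exact h2
  · exact absurd h1 hi

end Envelope

/-! ### Existence of the envelope -/

/-- **Existence of the algebraic envelope** in `m` variables: if `x₀, …, x_{m-1}` are algebraic
over `ℚ(θ)`, the regular representation of `ℚ(θ)(x)` over `ℚ(θ)`, with denominators cleared,
is an `Envelope θ x` (proof copied from `Chudnovsky.exists_envelope`). [folklore] -/
theorem exists_envelope {m : ℕ} (θ : ℂ) (x : Fin m → ℂ) (hx : ∀ l, IsAlgebraic ℚ⟮θ⟯ (x l)) :
    Nonempty (Envelope θ x) := by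
  classical
  -- the fields `K₀ = ℚ(θ) ⊆ K = K₀(x) ⊆ ℂ`
  set K₀ : IntermediateField ℚ ℂ := ℚ⟮θ⟯ with hK₀
  let K : IntermediateField K₀ ℂ := IntermediateField.adjoin K₀ (Set.range x)
  haveI hfin : FiniteDimensional K₀ K :=
    IntermediateField.finiteDimensional_adjoin fun y hy => by
      obtain ⟨l, rfl⟩ := hy
      exact (hx l).isIntegral
  set d : ℕ := Module.finrank K₀ K with hd_def
  let bK : Module.Basis (Fin d) K₀ K := Module.finBasis K₀ K
  have hd : 0 < d := Module.finrank_pos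
  let θ₀ : K₀ := ⟨θ, IntermediateField.mem_adjoin_simple_self ℚ θ⟩
  let xK : Fin m → K := fun l => ⟨x l, IntermediateField.subset_adjoin K₀ _ ⟨l, rfl⟩⟩
  let M : Fin m → Matrix (Fin d) (Fin d) K₀ := fun l => Algebra.leftMulMatrix bK (xK l)
  -- clearing denominators
  have hq : ∀ t : Fin m × Fin d × Fin d, ∃ RS : ℤ[X] × ℤ[X], Polynomial.aeval θ RS.2 ≠ 0 ∧
      ((M t.1 t.2.1 t.2.2 : K₀) : ℂ) * Polynomial.aeval θ RS.2 = Polynomial.aeval θ RS.1 := by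
    intro t
    obtain ⟨R, S, h1, h2⟩ := exists_int_poly_of_mem_adjoin θ (M t.1 t.2.1 t.2.2).2
    exact ⟨(R, S), h1, h2⟩
  choose RS hS hRS using hq
  let b : ℤ[X] := ∏ t, (RS t).2
  let N : Fin m → Matrix (Fin d) (Fin d) ℤ[X] := fun l =>
    Matrix.of fun i j => (RS (l, i, j)).1 * ∏ t ∈ Finset.univ.erase (l, i, j), (RS t).2
  have hbθ : Polynomial.aeval θ b ≠ 0 := by
    simp only [b, map_prod]
    exact Finset.prod_ne_zero_iff.mpr fun t _ => hS t
  -- `N_l(θ) = b(θ) M_l`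
  have hNθ : ∀ l i j, Polynomial.aeval θ (N l i j) = Polynomial.aeval θ b * ((M l i j : K₀) : ℂ) := by
    intro l i j
    simp only [N, b, Matrix.of_apply, map_mul, map_prod]
    rw [← hRS (l, i, j), ← Finset.mul_prod_erase Finset.univ _ (Finset.mem_univ (l, i, j))]
    ring
  let φ : ℤ[X] →+* ℂ := (Polynomial.aeval θ : ℤ[X] →ₐ[ℤ] ℂ).toRingHom
  -- the basis as complex numbers, and the eigenvector relation
  let β : Fin d → ℂ := fun i => ((bK i : K) : ℂ)
  have hβ : β ≠ 0 := by
    intro h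
    have h0 := congr_fun h ⟨0, hd⟩
    simp only [β, Pi.zero_apply, ZeroMemClass.coe_eq_zero] at h0
    exact bK.ne_zero _ h0
  have heigenK : ∀ l j, (xK l : K) * bK j = ∑ i, M l i j • bK i := by
    intro l j
    conv_lhs => rw [← bK.sum_repr (xK l * bK j)]
    simp only [M, Algebra.leftMulMatrix_eq_repr_mul]
  have heigen : ∀ l, Matrix.vecMul β ((N l).map φ) = (Polynomial.aeval θ b * x l) • β := by
    intro l
    ext j
    have h := congrArg (fun z : K => (z : ℂ)) (heigenK l j)
    simp only [MulMemClass.coe_mul, IntermediateField.coe_sum, IntermediateField.coe_smul,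
      IntermediateField.smul_def, smul_eq_mul] at h
    simp only [Matrix.vecMul, dotProduct, Matrix.map_apply, Pi.smul_apply, smul_eq_mul]
    change ∑ i, β i * φ (N l i j) = _
    simp only [φ, AlgHom.toRingHom_eq_coe, RingHom.coe_coe, hNθ]
    have : x l * β j = ∑ i, ((M l i j : K₀) : ℂ) * β i := h
    calc ∑ i, β i * (Polynomial.aeval θ b * ((M l i j : K₀) : ℂ))
        = Polynomial.aeval θ b * ∑ i, ((M l i j : K₀) : ℂ) * β i := by
          rw [Finset.mul_sum]; exact Finset.sum_congr rfl fun i _ => by ring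
      _ = Polynomial.aeval θ b * x l * β j := by rw [← this]; ring
  -- the evaluation `ℤ[T][a] → K` and the representation `ρ`
  have hθ₀ : algebraMap K₀ ℂ θ₀ = θ := rfl
  have haevalC : ∀ p : ℤ[X], algebraMap K₀ ℂ (Polynomial.aeval θ₀ p) = Polynomial.aeval θ p := by
    intro p
    rw [← Polynomial.aeval_algebraMap_apply ℂ θ₀ p, hθ₀]
  let evK : MvPolynomial (Fin m) ℤ[X] →+* K :=
    MvPolynomial.eval₂Hom (Polynomial.aeval (algebraMap K₀ K θ₀) : ℤ[X] →ₐ[ℤ] K).toRingHom xK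
  have hevKC : ∀ p : ℤ[X], evK (C p) = algebraMap K₀ K (Polynomial.aeval θ₀ p) := by
    intro p
    simp only [evK, MvPolynomial.coe_eval₂Hom, MvPolynomial.eval₂_C, AlgHom.toRingHom_eq_coe,
      RingHom.coe_coe]
    rw [Polynomial.aeval_algebraMap_apply]
  have hevK : ∀ P, ((evK P : K) : ℂ) = evC θ x P := by
    intro P
    change ((algebraMap K ℂ).comp evK) P = evC θ x P
    congr 1
    refine MvPolynomial.ringHom_ext (fun p => ?_) (fun l => ?_)
    · rw [RingHom.coe_comp, Function.comp_apply, evC_C, hevKC, IntermediateField.algebraMap_apply,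
        IntermediateField.coe_algebraMap_apply, haevalC]
    · simp [evK, evC, xK]
  let ι : Matrix (Fin d) (Fin d) K₀ →+* Matrix (Fin d) (Fin d) ℂ := (algebraMap K₀ ℂ).mapMatrix
  let ρ : MvPolynomial (Fin m) ℤ[X] →+* Matrix (Fin d) (Fin d) ℂ :=
    ι.comp ((Algebra.leftMulMatrix bK).toRingHom.comp evK)
  have hρX : ∀ l, ρ (X l) = ι (M l) := by
    intro l
    simp [ρ, evK, M]
  have hρC : ∀ p : ℤ[X], ρ (C p) = Polynomial.aeval θ p • (1 : Matrix (Fin d) (Fin d) ℂ) := by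
    intro p
    simp only [ρ, RingHom.coe_comp, Function.comp_apply, hevKC, AlgHom.toRingHom_eq_coe,
      RingHom.coe_coe, AlgHom.commutes, Matrix.algebraMap_eq_diagonal, ι, RingHom.mapMatrix_apply,
      Pi.algebraMap_def, Algebra.algebraMap_self_apply]
    rw [Matrix.diagonal_map (map_zero _), Matrix.smul_one_eq_diagonal]
    simp only [haevalC]
  have hNmap : ∀ l, (N l).map φ = Polynomial.aeval θ b • ι (M l) := by
    intro l
    ext i j
    simp only [Matrix.map_apply, Matrix.smul_apply, smul_eq_mul, ι, RingHom.mapMatrix_apply]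
    exact hNθ l i j
  -- `(homEval N b n P)(θ) = b(θ)^n ρ(P)` when `deg P ≤ n`
  have hhom : ∀ (n : ℕ) (P : MvPolynomial (Fin m) ℤ[X]), (∀ α ∈ P.support, α.degree ≤ n) →
      (homEval N b n P).map φ = Polynomial.aeval θ b ^ n • ρ P := by
    intro n P hP
    rw [homEval_map, homEval_eq_sum_of_subset _ _ n (support_map_subset φ P)]
    conv_rhs => rw [P.as_sum, map_sum, Finset.smul_sum]
    refine Finset.sum_congr rfl fun α hα => ?_
    rw [MvPolynomial.coeff_map]
    have hmono : monoEval (fun l => (N l).map φ) α =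
        Polynomial.aeval θ b ^ α.degree • monoEval (fun l => ι (M l)) α := by
      simp_rw [hNmap]
      rw [monoEval_smul, Finsupp.degree_eq_sum]
    have hρmono : ρ (monomial α (P.coeff α)) = φ (P.coeff α) • monoEval (fun l => ι (M l)) α := by
      have hmon : monomial α (P.coeff α) = C (P.coeff α) * monomial α 1 := by
        rw [C_mul_monomial, mul_one]
      rw [hmon, map_mul, hρC, map_monomial_eq_monoEval, smul_one_mul]
      simp_rw [hρX]
      rfl
    have hφb : φ b = Polynomial.aeval θ b := rfl
    rw [hmono, hρmono, smul_smul, smul_smul, hφb, mul_assoc, ← pow_add,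
      Nat.sub_add_cancel (hP α hα), mul_comm]
  refine ⟨Envelope.mk d hd N b hbθ β hβ heigen ?_⟩
  intro n P hP hev
  have hPK : evK P ≠ 0 := by
    intro h0
    apply hev
    rw [← hevK, h0]
    rfl
  haveI : Module.Free K₀ K := Module.Free.of_divisionRing K₀ K
  haveI : Module.Finite K₀ K := hfin
  have hnorm : Algebra.norm K₀ (evK P) ≠ 0 := Algebra.norm_ne_zero_iff.mpr hPK
  have hdetρ : (ρ P).det = algebraMap K₀ ℂ (Algebra.norm K₀ (evK P)) := by
    rw [Algebra.norm_eq_matrix_det bK, RingHom.map_det]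
    rfl
  change φ (homEval N b n P).det ≠ 0
  rw [RingHom.map_det]
  change ((homEval N b n P).map φ).det ≠ 0
  rw [hhom n P hP, Matrix.det_smul, hdetρ, Fintype.card_fin]
  exact mul_ne_zero (pow_ne_zero _ (pow_ne_zero _ hbθ)) ((map_ne_zero _).mpr hnorm)

/-- Degree and height bounds for the data of an envelope (a crude common bound). [folklore] -/
theorem Envelope.exists_bounds {m : ℕ} {θ : ℂ} {x : Fin m → ℂ} (E : Envelope θ x) :
    ∃ (δ₀ : ℕ) (H₀ : ℝ), (∀ l i j, (E.N l i j).natDegree ≤ δ₀) ∧ E.b.natDegree ≤ δ₀ ∧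
      1 ≤ H₀ ∧ (∀ l i j, zl1 (E.N l i j) ≤ H₀) ∧ zl1 E.b ≤ H₀ := by
  refine ⟨E.b.natDegree + ∑ t : Fin m × Fin E.d × Fin E.d, (E.N t.1 t.2.1 t.2.2).natDegree,
    1 + zl1 E.b + ∑ t : Fin m × Fin E.d × Fin E.d, zl1 (E.N t.1 t.2.1 t.2.2),
    fun l i j => ?_, Nat.le_add_right _ _, ?_, fun l i j => ?_, ?_⟩
  · have := Finset.single_le_sum (f := fun t : Fin m × Fin E.d × Fin E.d =>
      (E.N t.1 t.2.1 t.2.2).natDegree) (fun t _ => Nat.zero_le _) (Finset.mem_univ (l, i, j))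
    simp only at this
    omega
  · have hsum0 : 0 ≤ ∑ t : Fin m × Fin E.d × Fin E.d, zl1 (E.N t.1 t.2.1 t.2.2) :=
      Finset.sum_nonneg fun t _ => apply_nonneg _ _
    have hb0 : 0 ≤ zl1 E.b := apply_nonneg _ _
    linarith
  · have := Finset.single_le_sum (f := fun t : Fin m × Fin E.d × Fin E.d =>
      zl1 (E.N t.1 t.2.1 t.2.2)) (fun t _ => apply_nonneg _ _) (Finset.mem_univ (l, i, j))
    simp only at this
    have hb0 : 0 ≤ zl1 E.b := apply_nonneg _ _
    linarith
  · have hsum0 : 0 ≤ ∑ t : Fin m × Fin E.d × Fin E.d, zl1 (E.N t.1 t.2.1 t.2.2) :=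
      Finset.sum_nonneg fun t _ => apply_nonneg _ _
    linarith

end Literature.NumberTheory.Transcendental.BrownawellWaldschmidt

end
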